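import Summits.Ventures.CertifiedQuantumChemistry.Rows.SingletSpinAdaptationLossless
import Literature.MathematicalPhysics.QuantumChemistry.SpinAveragedPair
import Literature.MathematicalPhysics.QuantumChemistry.SpinAdaptedSingletLowerBound
import Literature.MathematicalPhysics.QuantumChemistry.RelaxationRealRestriction
import HarnessLib

/-!
# Ventures/CertifiedQuantumChemistry — Rows/SingletSpinAdaptationLosslessBlocks.lean: the explicit
# (six-block, `S = 0`) spin adaptation of the singlet 2-RDM programme is VALUE-LOSSLESS

HONEST FRAMING (verbatim): certified bounds for a stated model Hamiltonian in a stated basis; not a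
claim about the real molecule beyond that model.

Seat chem-type-03 (typer slot 03c, cell chem-oracle, LADDER-CHEM I-TYPE), ROWS file (theorems only; no
`def`, no notation; zero compute; nothing landed is touched). `Rows/SingletSpinAdaptationLossless.lean`
(rdm-A) proves Gatermann–Parrilo's Theorem 3.3 for the singlet programme and ANY finite group of spin
rotations `ρ(g) = 1 ⊗ υ(g)` (`le_pqgSingletEnergy_iff_spinRotationInvariant`: the bound may be checked on
the `ρ`-INVARIANT singlet-feasible pairs only) and closes with the words-only remark "for a finite
`G ⊂ SU(2)` whose rotation image acts irreducibly on `ℝ³` … the `ρ`-invariant pairs are exactly the fully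
spin-adapted ones (`γ = γ^{sf} ⊗ 1`; `Γ` = singlet ⊕ triplet blocks, Mazziotti 2007 §II.F (87)–(95))".
This file makes that remark a theorem in the EXPLICIT variables of the typer's
`IsSpinAdaptedPair` (`GConditionSpinAdapted.lean`: the seven uncoupled relation families under which
`D, Q, G ⪰ 0 ⟺` the six spin-coupled blocks `Γ⁰, Γ¹, 𝒬⁰, 𝒬¹, 𝒢⁰, 𝒢¹ ⪰ 0`, files
`D/Q/GConditionSpinAdapted.lean`), using the closed-form spin-averaging projection `P = (P¹, P²)` and
the twelve binary-tetrahedral spin rotations `u_g` of `Literature/…/SpinAveragedPair.lean` (a unitary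
2-design: Bengtsson–Życzkowski §12.7, "For qubits, the minimal unitary 2-design is the tetrahedral group,
which has only 12 elements"):

* §1 **`spinAverageOne_eq_sum_conj`**, **`spinAverageTwo_eq_sum_conj`** — `P¹γ = (1/12) Σ_g U_g γ U_g†`
  and `P²Γ = (1/12) Σ_g (U_g⊗U_g) Γ (U_g⊗U_g)†` with `U_g = 1 ⊗ u_g` (`spinLift`): the Haar (Reynolds)
  average over ALL spin rotations is the finite tetrahedral average (rdm-A's entry formulas
  `conj_spinLift_one/two_apply` + the design's second/fourth moment identities
  `sum_tetrahedralRotation_two/four`, kernel-checked numerics);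
* §2 **`isDQGFeasibleSinglet_spinAverage`**, **`isDQGT1T2PrimeFeasibleSinglet_spinAverage`** — `P` maps the
  singlet-feasible sets (`DQG + row (98)`, resp. `DQGT1T2′ + row (98)`) INTO THEMSELVES (covariance
  for each `u_g`, rdm-A's `isDQG(T1T2Prime)FeasibleSinglet_conj_spinLift`, + convexity, the typer's
  `IsDQG(T1T2Prime)FeasibleSinglet.sum_smul`); the image is spin-adapted (`isSpinAdaptedPair_spinAverage`)
  and has the same energy (`rdmEnergy_spinAverage`);
* §3 **`le_pqgSingletEnergy_iff_spinAdapted`** — `c ≤ E_PQG(2n, S = 0)` iff `c ≤ Re E_{h,g}` on the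
  SPIN-ADAPTED singlet-feasible pairs only (`n ≤ |Λ|`, every integral table), i.e. Gatermann–Parrilo
  Thm 3.3 with the fixed-point subspace written out; **`le_pqgT1T2pSingletEnergy_iff_spinAdapted`** (the
  `PQGT1T2′` rung); **`pqgSingletEnergy_eq_sInf_spinAdapted`** (the VALUE: `E_PQG(2n, S=0)` is the infimum
  over spin-adapted singlet-feasible pairs); `exists_spinAdapted_rdmEnergy_eq_pqgSingletEnergy` /
  `…pqgT1T2pSingletEnergy` (attained at a spin-adapted pair);
* §4 **`le_pqgSingletEnergy_iff_sixBlocks`** — the bound form a singlet-adapted (`su2`) instance needs: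
  `c ≤ E_PQG(2n, S=0)` iff `c ≤ Re E` on the pairs satisfying the singlet rows, the `IsSpinAdaptedPair`
  relations AND the six blocks `Γ⁰, Γ¹, 𝒬⁰, 𝒬¹, 𝒢⁰, 𝒢¹ ⪰ 0` (which there REPLACE nothing and ADD nothing:
  on spin-adapted feasible pairs they hold, `spinAdaptedBlocks_of_isDQGFeasibleSinglet`) — so the
  six-block programme that v2RDM codes solve ("only two distinct blocks must be constrained",
  Mazziotti p. 49; "all matrix manipulations can be restricted to one copy", Verstichel ch. 3 §1.1) has
  EXACTLY the value `E_PQG(2n, S = 0)` of the printed singlet programme, not merely a lower bound of it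
  (soundness alone is the typer's `le_minEnergyOn_singlet_of_forall_spinAdapted`);
* §5 **`isSpinAdaptedPair_iff_forall_conj_tetrahedral`** — a pair is spin-adapted IFF it is invariant under
  the twelve tetrahedral spin lifts (`isSpinAdaptedPair_of_forall_conj_tetrahedral`: an invariant pair equals
  its tetrahedral average `= P(γ, Γ)`; `conj_spinLift_eq_of_isSpinAdaptedPair`: a spin-adapted pair is
  invariant under EVERY unitary spin lift `1 ⊗ u`, by unitarity `Σ_a u_{σa} ū_{τa} = δ_{στ}`) — rdm-A's
  remark in full, for the smallest admissible rotation group; so rdm-A's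
  `le_pqgSingletEnergy_iff_spinRotationInvariant` (any finite group) and §3 describe the same fixed-point set.
Everything is PROVED (0 sorry, standard axioms); no definitions, no named facts; nothing asserts a bound
about any model; no claim node, no hint / row depends on it. Cell context (words): chem-solver-2's
DESIGN R3 lists "full SU(2) coupling (÷3–4 memory, ÷6–8 flops) — UNTRIED"; this file says the lever is
free of any loss of bound. NOT here: the explicit block structure at the `T1/T2′` rung (Verstichel
§1.3's `𝒯₁/𝒯₂` blocks); `S > 0`.

References: K. Gatermann, P. A. Parrilo, J. Pure Appl. Algebra 192 (2004) 95–128, §3 Thm 3.3 (held copy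
`paper:arxiv-math_0211450` p. 8, opened 2026-08-27). [cite: GatermannParrilo2004, §3 Thm 3.3]
D. A. Mazziotti, Adv. Chem. Phys. 134 (2007) ch. 3 §II.F pp. 47–49 (held copy opened).
[cite: Mazziotti2007RDMChapter, §II.F pp. 47-49] B. Verstichel, PhD thesis (Ghent 2012) =
arXiv:1203.5659 ch. 3 §1.1 (held copy p. 39–40 opened). [cite: Verstichel2012Thesis, ch. 3 §1.1]
I. Bengtsson, K. Życzkowski, Geometry of Quantum States (2nd ed., CUP 2017) §12.7 pp. 348–349 (held copy
opened). [cite: BengtssonZyczkowski2017, §12.7 eq. (12.99)]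
Tree (REUSED): `conj_spinLift_one_apply`, `conj_spinLift_two_apply`, `isDQGFeasibleSinglet_conj_spinLift`,
`isDQGT1T2PrimeFeasibleSinglet_conj_spinLift` (rdm-A); `IsDQGFeasibleSinglet.sum_smul`,
`IsDQGT1T2PrimeFeasibleSinglet.sum_smul`, `le_pqgSingletEnergy_iff`, `pqgT1T2pSingletEnergySet_bddBelow /
_nonempty`, `exists_isDQGFeasibleSinglet_rdmEnergy_eq_pqgSingletEnergy`,
`exists_isDQGT1T2PrimeFeasibleSinglet_rdmEnergy_eq_pqgT1T2pSingletEnergy`,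
`spinAdaptedBlocks_of_isDQGFeasibleSinglet` (typer); `spinLift`, `tetrahedralRotation`,
`spinAverageOne/Two`, `isSpinAdaptedPair_spinAverage`, `rdmEnergy_spinAverage`,
`isSpinAdaptedPair_iff_spinAverage_eq`, `sum_tetrahedralRotation_two/four`,
`tetrahedralRotation_mul_conjTranspose` (typer, `SpinAveragedPair.lean`).
-/

noncomputable section

namespace Summit.Ventures.CertifiedQuantumChemistry

open Matrix Finset
open Literature.MathematicalPhysics.QuantumLattice Literature.MathematicalPhysics.QuantumChemistry
open scoped ComplexOrder Kronecker

variable {Λ : Type*} [LinearOrder Λ] [Fintype Λ]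

/-! ## §1 The spin-averaging projection is the tetrahedral rotation average -/

/-- The uniform weights `1/12` on `Fin 12` sum to one. -/
private theorem sum_twelfth_eq_one : ∑ _g : Fin 12, (1 / 12 : ℝ) = 1 := by
  rw [Finset.sum_const, Finset.card_univ, Fintype.card_fin, nsmul_eq_mul]
  norm_num

omit [LinearOrder Λ] [Fintype Λ] in
/-- Two matrices on the spin orbitals agree iff they agree at all labels `orb p σ`. -/
private theorem ext_orb {M N : Matrix (Orb Λ) (Orb Λ) ℂ}
    (hMN : ∀ (p q : Λ) (σ τ : Fin 2), M (orb p σ) (orb q τ) = N (orb p σ) (orb q τ)) : M = N := by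
  ext P Q
  exact hMN (ofLex P).1 (ofLex Q).1 (ofLex P).2 (ofLex Q).2

omit [LinearOrder Λ] [Fintype Λ] in
/-- Two matrices on pairs of spin orbitals agree iff they agree at all labels `(orb p σ, orb r τ)`. -/
private theorem ext_orb₂ {M N : Matrix (Orb Λ × Orb Λ) (Orb Λ × Orb Λ) ℂ}
    (hMN : ∀ (p r q s : Λ) (σ τ σ' τ' : Fin 2),
      M (orb p σ, orb r τ) (orb q σ', orb s τ') = N (orb p σ, orb r τ) (orb q σ', orb s τ')) : M = N := by
  ext I J
  exact hMN (ofLex I.1).1 (ofLex I.2).1 (ofLex J.1).1 (ofLex J.2).1 (ofLex I.1).2 (ofLex I.2).2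
    (ofLex J.1).2 (ofLex J.2).2

/-- **`P¹γ = (1/12) Σ_g U_g γ U_g†`**, `U_g = 1 ⊗ u_g` the twelve tetrahedral spin lifts (entrywise: rdm-A's
`conj_spinLift_one_apply` and the second-moment identity `Σ_g u ⊗ ū = 6·δδ`).
[cite: BengtssonZyczkowski2017, §12.7 eq. (12.99)] -/
theorem spinAverageOne_eq_sum_conj (γ : Matrix (Orb Λ) (Orb Λ) ℂ) :
    spinAverageOne γ = ∑ g : Fin 12, (((1 / 12 : ℝ) : ℝ) : ℂ) •
      (spinLift (tetrahedralRotation g) * γ * (spinLift (tetrahedralRotation g))ᴴ) := by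
  refine ext_orb fun p q σ τ => ?_
  rw [Matrix.sum_apply]
  simp only [Matrix.smul_apply, smul_eq_mul,
    conj_spinLift_one_apply (spinLift_apply (tetrahedralRotation _)), Fin.sum_univ_two, mul_add,
    Finset.sum_add_distrib]
  simp only [← mul_assoc, ← Finset.sum_mul]
  simp only [mul_assoc, ← Finset.mul_sum, sum_tetrahedralRotation_two, spinAverageOne_apply,
    Fin.sum_univ_two, Fin.isValue, and_true, and_false, one_ne_zero, zero_ne_one, if_false]
  split_ifs <;> push_cast <;> ring

/-- **`P²Γ = (1/12) Σ_g (U_g⊗U_g) Γ (U_g⊗U_g)†`** (entrywise: rdm-A's `conj_spinLift_two_apply` and the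
fourth-moment identity of the design; the sixteen spin patterns are then ring identities).
[cite: BengtssonZyczkowski2017, §12.7 eq. (12.99)] -/
theorem spinAverageTwo_eq_sum_conj (Γ : Matrix (Orb Λ × Orb Λ) (Orb Λ × Orb Λ) ℂ) :
    spinAverageTwo Γ = ∑ g : Fin 12, (((1 / 12 : ℝ) : ℝ) : ℂ) •
      (spinLift (tetrahedralRotation g) ⊗ₖ spinLift (tetrahedralRotation g) * Γ *
        (spinLift (tetrahedralRotation g) ⊗ₖ spinLift (tetrahedralRotation g))ᴴ) := by
  refine ext_orb₂ fun p r q s σ τ σ' τ' => ?_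
  rw [Matrix.sum_apply]
  simp only [Matrix.smul_apply, smul_eq_mul,
    conj_spinLift_two_apply (spinLift_apply (tetrahedralRotation _))]
  rw [← Finset.mul_sum, Finset.sum_comm]
  simp only [← Finset.sum_mul, sum_tetrahedralRotation_four]
  rw [spinAverageTwo_apply]
  simp only [Fintype.sum_prod_type, Fin.sum_univ_two, Fin.isValue]
  fin_cases σ <;> fin_cases τ <;> fin_cases σ' <;> fin_cases τ'
  all_goals simp only [Fin.zero_eta, Fin.mk_one, Fin.isValue, and_self, and_true, and_false,
    if_true, if_false, one_ne_zero, zero_ne_one]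
  all_goals push_cast
  all_goals ring

/-! ## §2 The projection preserves singlet feasibility (both rungs) -/

/-- **`P` maps the `DQG` singlet-feasible set into itself**: `P(γ, Γ)` is the average of the twelve
rotated pairs, each singlet-feasible (rdm-A's covariance), and the feasible set is convex.
[cite: GatermannParrilo2004, §3 Thm 3.3] -/
theorem isDQGFeasibleSinglet_spinAverage {n : ℕ} {γ : Matrix (Orb Λ) (Orb Λ) ℂ}
    {Γ : Matrix (Orb Λ × Orb Λ) (Orb Λ × Orb Λ) ℂ} (hf : IsDQGFeasibleSinglet n γ Γ) :
    IsDQGFeasibleSinglet n (spinAverageOne γ) (spinAverageTwo Γ) := by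
  rw [spinAverageOne_eq_sum_conj, spinAverageTwo_eq_sum_conj]
  exact IsDQGFeasibleSinglet.sum_smul Finset.univ (fun _ => (1 / 12 : ℝ)) (fun _ _ => by norm_num)
    sum_twelfth_eq_one fun g _ =>
      isDQGFeasibleSinglet_conj_spinLift (spinLift_apply (tetrahedralRotation g))
        (tetrahedralRotation_mul_conjTranspose g) hf

/-- **`P` maps the `DQGT1T2′` singlet-feasible set into itself** (same argument at the three-index
rung). [cite: GatermannParrilo2004, §3 Thm 3.3] -/
theorem isDQGT1T2PrimeFeasibleSinglet_spinAverage {n : ℕ} {γ : Matrix (Orb Λ) (Orb Λ) ℂ}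
    {Γ : Matrix (Orb Λ × Orb Λ) (Orb Λ × Orb Λ) ℂ} (hf : IsDQGT1T2PrimeFeasibleSinglet n γ Γ) :
    IsDQGT1T2PrimeFeasibleSinglet n (spinAverageOne γ) (spinAverageTwo Γ) := by
  rw [spinAverageOne_eq_sum_conj, spinAverageTwo_eq_sum_conj]
  exact IsDQGT1T2PrimeFeasibleSinglet.sum_smul Finset.univ (fun _ => (1 / 12 : ℝ))
    (fun _ _ => by norm_num) sum_twelfth_eq_one fun g _ =>
      isDQGT1T2PrimeFeasibleSinglet_conj_spinLift (spinLift_apply (tetrahedralRotation g))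
        (tetrahedralRotation_mul_conjTranspose g) hf

/-! ## §3 Spin adaptation of the singlet programme is value-lossless -/

/-- **SPIN ADAPTATION IS LOSSLESS, explicit form (`DQG` rung).** For every integral table and
`n ≤ |Λ|`: `c ≤ E_PQG(2n, S = 0)` iff `c ≤ Re E_{h,g}(γ, Γ)` for every singlet-feasible pair that is
moreover SPIN-ADAPTED (`IsSpinAdaptedPair`: `Ŝ_z` selection rules, spin-flip symmetry, triplet
relations) — Gatermann–Parrilo Thm 3.3 ("the optimal values `F`, `F_σ` of the original semidefinite
program and the fixed-point restricted semidefinite program are equal") with the fixed-point subspace of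
the spin rotations written out (`isSpinAdaptedPair_iff_spinAverage_eq`).
[cite: GatermannParrilo2004, §3 Thm 3.3] -/
theorem le_pqgSingletEnergy_iff_spinAdapted (h : Λ → Λ → ℂ) (g₂ : Λ → Λ → Λ → Λ → ℂ) (hnuc : ℂ)
    {n : ℕ} (hn : n ≤ Fintype.card Λ) (c : ℝ) :
    c ≤ pqgSingletEnergy h g₂ hnuc n ↔
      ∀ γ Γ, IsDQGFeasibleSinglet n γ Γ → IsSpinAdaptedPair γ Γ → c ≤ (rdmEnergy h g₂ hnuc γ Γ).re := by
  rw [le_pqgSingletEnergy_iff h g₂ hnuc hn]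
  refine ⟨fun hc γ Γ hf _ => hc γ Γ hf, fun hc γ Γ hf => ?_⟩
  rw [← rdmEnergy_spinAverage h g₂ hnuc γ Γ]
  exact hc _ _ (isDQGFeasibleSinglet_spinAverage hf) (isSpinAdaptedPair_spinAverage γ Γ)

/-- **SPIN ADAPTATION IS LOSSLESS, `PQGT1T2′` rung**: `c ≤ E_PQGT1T2′(2n, S = 0)` iff `c` lies below
`Re E_{h,g}` on the spin-adapted `DQGT1T2′`-singlet-feasible pairs only.
[cite: GatermannParrilo2004, §3 Thm 3.3] -/
theorem le_pqgT1T2pSingletEnergy_iff_spinAdapted (h : Λ → Λ → ℂ) (g₂ : Λ → Λ → Λ → Λ → ℂ)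
    (hnuc : ℂ) {n : ℕ} (hn : n ≤ Fintype.card Λ) (c : ℝ) :
    c ≤ pqgT1T2pSingletEnergy h g₂ hnuc n ↔
      ∀ γ Γ, IsDQGT1T2PrimeFeasibleSinglet n γ Γ → IsSpinAdaptedPair γ Γ →
        c ≤ (rdmEnergy h g₂ hnuc γ Γ).re := by
  rw [pqgT1T2pSingletEnergy, le_csInf_iff (pqgT1T2pSingletEnergySet_bddBelow h g₂ hnuc n)
    (pqgT1T2pSingletEnergySet_nonempty h g₂ hnuc hn)]
  constructor
  · rintro hc γ Γ hf -
    exact hc _ ⟨γ, Γ, hf, rfl⟩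
  · rintro hc E ⟨γ, Γ, hf, rfl⟩
    rw [← rdmEnergy_spinAverage h g₂ hnuc γ Γ]
    exact hc _ _ (isDQGT1T2PrimeFeasibleSinglet_spinAverage hf) (isSpinAdaptedPair_spinAverage γ Γ)

/-- **THE VALUE**: `E_PQG(2n, S = 0) = inf {Re E_{h,g}(γ, Γ) : (γ, Γ) singlet-feasible AND spin-adapted}`
(`n ≤ |Λ|`) — the spin-adapted programme and the printed singlet programme have the same optimal value.
[cite: GatermannParrilo2004, §3 Thm 3.3] -/
theorem pqgSingletEnergy_eq_sInf_spinAdapted (h : Λ → Λ → ℂ) (g₂ : Λ → Λ → Λ → Λ → ℂ) (hnuc : ℂ)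
    {n : ℕ} (hn : n ≤ Fintype.card Λ) :
    pqgSingletEnergy h g₂ hnuc n = sInf {E : ℝ | ∃ γ Γ, IsDQGFeasibleSinglet n γ Γ ∧
      IsSpinAdaptedPair γ Γ ∧ E = (rdmEnergy h g₂ hnuc γ Γ).re} := by
  have hbdd : BddBelow {E : ℝ | ∃ γ Γ, IsDQGFeasibleSinglet n γ Γ ∧ IsSpinAdaptedPair γ Γ ∧
      E = (rdmEnergy h g₂ hnuc γ Γ).re} := by
    refine (pqgSingletEnergySet_bddBelow h g₂ hnuc n).mono ?_
    rintro E ⟨γ, Γ, hf, -, rfl⟩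
    exact ⟨γ, Γ, hf, rfl⟩
  have hne : {E : ℝ | ∃ γ Γ, IsDQGFeasibleSinglet n γ Γ ∧ IsSpinAdaptedPair γ Γ ∧
      E = (rdmEnergy h g₂ hnuc γ Γ).re}.Nonempty := by
    obtain ⟨E, γ, Γ, hf, -⟩ := pqgSingletEnergySet_nonempty h g₂ hnuc hn
    exact ⟨_, _, _, isDQGFeasibleSinglet_spinAverage hf, isSpinAdaptedPair_spinAverage γ Γ, rfl⟩
  refine le_antisymm ?_ ?_
  · refine le_csInf hne ?_
    rintro E ⟨γ, Γ, hf, -, rfl⟩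
    exact pqgSingletEnergy_le_rdmEnergy h g₂ hnuc hf
  · rw [le_pqgSingletEnergy_iff_spinAdapted h g₂ hnuc hn]
    intro γ Γ hf ha
    exact csInf_le hbdd ⟨γ, Γ, hf, ha, rfl⟩

/-- **The singlet value is ATTAINED at a spin-adapted pair** (`n ≤ |Λ|`): project a minimiser
(`exists_isDQGFeasibleSinglet_rdmEnergy_eq_pqgSingletEnergy`) with `P`.
[cite: GatermannParrilo2004, §3 Thm 3.3] -/
theorem exists_spinAdapted_rdmEnergy_eq_pqgSingletEnergy (h : Λ → Λ → ℂ)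
    (g₂ : Λ → Λ → Λ → Λ → ℂ) (hnuc : ℂ) {n : ℕ} (hn : n ≤ Fintype.card Λ) :
    ∃ γ Γ, IsDQGFeasibleSinglet n γ Γ ∧ IsSpinAdaptedPair γ Γ ∧
      (rdmEnergy h g₂ hnuc γ Γ).re = pqgSingletEnergy h g₂ hnuc n := by
  obtain ⟨γ, Γ, hf, hE⟩ := exists_isDQGFeasibleSinglet_rdmEnergy_eq_pqgSingletEnergy h g₂ hnuc hn
  exact ⟨_, _, isDQGFeasibleSinglet_spinAverage hf, isSpinAdaptedPair_spinAverage γ Γ,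
    by rw [rdmEnergy_spinAverage, hE]⟩

/-- **The `PQGT1T2′` singlet value is attained at a spin-adapted pair** (`n ≤ |Λ|`).
[cite: GatermannParrilo2004, §3 Thm 3.3] -/
theorem exists_spinAdapted_rdmEnergy_eq_pqgT1T2pSingletEnergy (h : Λ → Λ → ℂ)
    (g₂ : Λ → Λ → Λ → Λ → ℂ) (hnuc : ℂ) {n : ℕ} (hn : n ≤ Fintype.card Λ) :
    ∃ γ Γ, IsDQGT1T2PrimeFeasibleSinglet n γ Γ ∧ IsSpinAdaptedPair γ Γ ∧
      (rdmEnergy h g₂ hnuc γ Γ).re = pqgT1T2pSingletEnergy h g₂ hnuc n := by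
  obtain ⟨γ, Γ, hf, hE⟩ :=
    exists_isDQGT1T2PrimeFeasibleSinglet_rdmEnergy_eq_pqgT1T2pSingletEnergy h g₂ hnuc hn
  exact ⟨_, _, isDQGT1T2PrimeFeasibleSinglet_spinAverage hf, isSpinAdaptedPair_spinAverage γ Γ,
    by rw [rdmEnergy_spinAverage, hE]⟩

/-! ## §4 The six-block (singlet/triplet) form of the bound -/

/-- **THE SIX-BLOCK PROGRAMME HAS THE VALUE `E_PQG(2n, S = 0)`** (bound form, `n ≤ |Λ|`): `c ≤
E_PQG(2n, S=0)` iff `c ≤ Re E_{h,g}` on every pair satisfying the singlet rows, the `IsSpinAdaptedPair`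
relations and the six spin-coupled blocks `Γ⁰, Γ¹, 𝒬⁰, 𝒬¹, 𝒢⁰, 𝒢¹ ⪰ 0` ("only two distinct blocks must
be constrained" per condition, Mazziotti p. 49): these are the rows of a singlet-adapted instance, they
hold on the spin-adapted feasible pairs (`spinAdaptedBlocks_of_isDQGFeasibleSinglet`), and by §3 the
spin-adapted feasible pairs already decide the value. [cite: Mazziotti2007RDMChapter, §II.F pp. 47-49] -/
theorem le_pqgSingletEnergy_iff_sixBlocks (h : Λ → Λ → ℂ) (g₂ : Λ → Λ → Λ → Λ → ℂ) (hnuc : ℂ)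
    {n : ℕ} (hn : n ≤ Fintype.card Λ) (c : ℝ) :
    c ≤ pqgSingletEnergy h g₂ hnuc n ↔
      ∀ γ Γ, IsDQGFeasibleSinglet n γ Γ → IsSpinAdaptedPair γ Γ →
        (ppSingletBlock Γ).PosSemidef → (ppTripletBlock Γ).PosSemidef →
        (ppSingletBlock (qMap γ Γ)).PosSemidef → (ppTripletBlock (qMap γ Γ)).PosSemidef →
        (phSingletBlock (gMap γ Γ)).PosSemidef → (phTripletBlock (gMap γ Γ)).PosSemidef →
        c ≤ (rdmEnergy h g₂ hnuc γ Γ).re := by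
  rw [le_pqgSingletEnergy_iff_spinAdapted h g₂ hnuc hn]
  refine ⟨fun hc γ Γ hf ha _ _ _ _ _ _ => hc γ Γ hf ha, fun hc γ Γ hf ha => ?_⟩
  obtain ⟨h1, h2, h3, h4, h5, h6⟩ := spinAdaptedBlocks_of_isDQGFeasibleSinglet hf ha
  exact hc γ Γ hf ha h1 h2 h3 h4 h5 h6

/-- **On a spin-adapted singlet-feasible pair the whole 2-positivity content is the six blocks**: the
three printed conditions `D, Q, G ⪰ 0` are each EQUIVALENT to their two spin-coupled blocks (the
typer's `IsSpinAdaptedPair.dCondition_iff`, `IsSpinAdaptedPP.posSemidef_iff` for `qMap`,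
`IsSpinAdaptedPH.posSemidef_iff` for `gMap`, Hermiticity from feasibility).
[cite: Mazziotti2007RDMChapter, §II.F pp. 47-49] -/
theorem dqg_iff_sixBlocks_of_spinAdapted {n : ℕ} {γ : Matrix (Orb Λ) (Orb Λ) ℂ}
    {Γ : Matrix (Orb Λ × Orb Λ) (Orb Λ × Orb Λ) ℂ} (hf : IsDQGFeasibleSinglet n γ Γ)
    (ha : IsSpinAdaptedPair γ Γ) :
    (Γ.PosSemidef ↔ (ppSingletBlock Γ).PosSemidef ∧ (ppTripletBlock Γ).PosSemidef) ∧
      ((qMap γ Γ).PosSemidef ↔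
        (ppSingletBlock (qMap γ Γ)).PosSemidef ∧ (ppTripletBlock (qMap γ Γ)).PosSemidef) ∧
      ((gMap γ Γ).PosSemidef ↔
        (phSingletBlock (gMap γ Γ)).PosSemidef ∧ (phTripletBlock (gMap γ Γ)).PosSemidef) :=
  ⟨ha.dCondition_iff hf.dqg.d_psd.1, ha.isSpinAdaptedPP_qMap.posSemidef_iff hf.dqg.q_psd.1,
    ha.isSpinAdaptedPH_gMap.posSemidef_iff hf.dqg.g_psd.1⟩

/-! ## §5 Invariance under the twelve tetrahedral spin lifts forces spin adaptation -/

/-- **A pair invariant under the twelve tetrahedral spin rotations is spin-adapted** (rdm-A's remark,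
backward direction, for the smallest finite rotation group that qualifies): an invariant pair equals its
tetrahedral average, which is `P(γ, Γ)`, which is spin-adapted. [cite: GatermannParrilo2004, §3 Thm 3.3] -/
theorem isSpinAdaptedPair_of_forall_conj_tetrahedral {γ : Matrix (Orb Λ) (Orb Λ) ℂ}
    {Γ : Matrix (Orb Λ × Orb Λ) (Orb Λ × Orb Λ) ℂ}
    (hinv : ∀ g : Fin 12, spinLift (tetrahedralRotation g) * γ * (spinLift (tetrahedralRotation g))ᴴ = γ ∧
      spinLift (tetrahedralRotation g) ⊗ₖ spinLift (tetrahedralRotation g) * Γ *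
        (spinLift (tetrahedralRotation g) ⊗ₖ spinLift (tetrahedralRotation g))ᴴ = Γ) :
    IsSpinAdaptedPair γ Γ := by
  rw [isSpinAdaptedPair_iff_spinAverage_eq, spinAverageOne_eq_sum_conj, spinAverageTwo_eq_sum_conj]
  have hw : ∑ _g : Fin 12, (((1 / 12 : ℝ) : ℝ) : ℂ) = 1 := by
    rw [← Complex.ofReal_sum, sum_twelfth_eq_one, Complex.ofReal_one]
  constructor
  · rw [Finset.sum_congr rfl fun g _ => by rw [(hinv g).1], ← Finset.sum_smul, hw, one_smul]
  · rw [Finset.sum_congr rfl fun g _ => by rw [(hinv g).2], ← Finset.sum_smul, hw, one_smul]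

/-- `if P then x else 0 = [P]·x`. -/
private theorem ite_eq_boole_mul {P : Prop} [Decidable P] (x : ℂ) :
    (if P then x else 0) = (if P then (1 : ℂ) else 0) * x := by
  split_ifs <;> simp

/-- `if P ∧ Q then x else 0 = [P]·[Q]·x`. -/
private theorem ite_and_eq_boole_mul {P Q : Prop} [Decidable P] [Decidable Q] (x : ℂ) :
    (if P ∧ Q then x else 0) = (if P then (1 : ℂ) else 0) * (if Q then (1 : ℂ) else 0) * x := by
  by_cases hP : P <;> by_cases hQ : Q <;> simp [hP, hQ]

/-- **Conversely, a spin-adapted pair is invariant under EVERY unitary spin rotation** `U = 1 ⊗ u`,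
`uu† = 1` (not only the tetrahedral twelve): `P¹γ = g ⊗ 1` and `P²Γ = A ⊗ (1⊗1) + B ⊗ SWAP` in the spin
factor commute with `u ⊗ u`; entrywise this is unitarity `Σ_a u_{σa} ū_{τa} = δ_{στ}`. Together with
`isSpinAdaptedPair_of_forall_conj_tetrahedral`: spin-adapted ⟺ invariant under all spin rotations ⟺
invariant under the tetrahedral twelve — rdm-A's remark in full. [cite: GatermannParrilo2004, §3 Thm 3.3] -/
theorem conj_spinLift_eq_of_isSpinAdaptedPair {U : Matrix (Orb Λ) (Orb Λ) ℂ} {u : Matrix (Fin 2) (Fin 2) ℂ}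
    (hUu : ∀ p q σ τ, U (orb p σ) (orb q τ) = if p = q then u σ τ else 0) (hu : u * uᴴ = 1)
    {γ : Matrix (Orb Λ) (Orb Λ) ℂ} {Γ : Matrix (Orb Λ × Orb Λ) (Orb Λ × Orb Λ) ℂ}
    (ha : IsSpinAdaptedPair γ Γ) :
    U * γ * Uᴴ = γ ∧ U ⊗ₖ U * Γ * (U ⊗ₖ U)ᴴ = Γ := by
  have hU1 : ∀ σ τ : Fin 2, u σ 0 * star (u τ 0) + u σ 1 * star (u τ 1) = if σ = τ then 1 else 0 := by
    intro σ τ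
    have e := congr_fun (congr_fun hu σ) τ
    rwa [mul_apply, Fin.sum_univ_two, conjTranspose_apply, conjTranspose_apply, one_apply] at e
  constructor
  · refine ext_orb fun p q σ τ => ?_
    have hγ : ∀ a b : Fin 2, γ (orb p a) (orb q b) =
        if a = b then (1 / 2 : ℂ) * ∑ a' : Fin 2, γ (orb p a') (orb q a') else 0 := fun a b => by
      rw [← spinAverageOne_apply, ha.spinAverageOne_eq]
    generalize hS : (1 / 2 : ℂ) * ∑ a' : Fin 2, γ (orb p a') (orb q a') = S at hγ
    rw [conj_spinLift_one_apply hUu, hγ σ τ, ite_eq_boole_mul]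
    simp only [Fin.sum_univ_two, hγ, Fin.isValue, if_true, one_ne_zero, zero_ne_one, if_false, mul_zero,
      add_zero, zero_add]
    linear_combination S * hU1 σ τ
  · refine ext_orb₂ fun p r q s σ τ σ' τ' => ?_
    have hΓ : ∀ a c b d : Fin 2, Γ (orb p a, orb r c) (orb q b, orb s d) =
        (if a = b ∧ c = d then
            (1 / 3 : ℂ) * ∑ a' : Fin 2, ∑ c' : Fin 2, Γ (orb p a', orb r c') (orb q a', orb s c') -
              (1 / 6 : ℂ) * ∑ a' : Fin 2, ∑ c' : Fin 2, Γ (orb p a', orb r c') (orb q c', orb s a')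
          else 0) +
          (if a = d ∧ c = b then
              (1 / 3 : ℂ) * ∑ a' : Fin 2, ∑ c' : Fin 2, Γ (orb p a', orb r c') (orb q c', orb s a') -
                (1 / 6 : ℂ) * ∑ a' : Fin 2, ∑ c' : Fin 2, Γ (orb p a', orb r c') (orb q a', orb s c')
            else 0) := fun a c b d => by
      rw [← spinAverageTwo_apply, ha.spinAverageTwo_eq]
    -- abbreviate the two invariant amplitudes `A = ⅓X − ⅙Y`, `B = ⅓Y − ⅙X`
    generalize hA : (1 / 3 : ℂ) * ∑ a' : Fin 2, ∑ c' : Fin 2, Γ (orb p a', orb r c') (orb q a', orb s c') -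
        (1 / 6 : ℂ) * ∑ a' : Fin 2, ∑ c' : Fin 2, Γ (orb p a', orb r c') (orb q c', orb s a') = A at hΓ
    generalize hB : (1 / 3 : ℂ) * ∑ a' : Fin 2, ∑ c' : Fin 2, Γ (orb p a', orb r c') (orb q c', orb s a') -
        (1 / 6 : ℂ) * ∑ a' : Fin 2, ∑ c' : Fin 2, Γ (orb p a', orb r c') (orb q a', orb s c') = B at hΓ
    rw [conj_spinLift_two_apply hUu, hΓ σ τ σ' τ', ite_and_eq_boole_mul, ite_and_eq_boole_mul]
    simp only [Fintype.sum_prod_type, Fin.sum_univ_two, hΓ, Fin.isValue, and_self, and_true, and_false,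
      if_true, if_false, one_ne_zero, zero_ne_one, mul_zero, add_zero, zero_add]
    linear_combination (A * (u τ 0 * star (u τ' 0) + u τ 1 * star (u τ' 1))) * hU1 σ σ' +
      (A * (if σ = σ' then (1 : ℂ) else 0)) * hU1 τ τ' +
      (B * (u τ 0 * star (u σ' 0) + u τ 1 * star (u σ' 1))) * hU1 σ τ' +
      (B * (if σ = τ' then (1 : ℂ) else 0)) * hU1 τ σ'

/-- **SPIN-ADAPTED ⟺ INVARIANT UNDER THE TWELVE TETRAHEDRAL SPIN ROTATIONS** (hence under every
spin rotation): the fixed-point subspace of the tetrahedral group acting by `1 ⊗ u_g` on pairs is exactly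
the set of `IsSpinAdaptedPair` pairs — rdm-A's remark ("the `ρ`-invariant pairs are exactly the fully
spin-adapted ones") for the smallest admissible group. [cite: GatermannParrilo2004, §3 Thm 3.3] -/
theorem isSpinAdaptedPair_iff_forall_conj_tetrahedral (γ : Matrix (Orb Λ) (Orb Λ) ℂ)
    (Γ : Matrix (Orb Λ × Orb Λ) (Orb Λ × Orb Λ) ℂ) :
    IsSpinAdaptedPair γ Γ ↔
      ∀ g : Fin 12, spinLift (tetrahedralRotation g) * γ * (spinLift (tetrahedralRotation g))ᴴ = γ ∧
        spinLift (tetrahedralRotation g) ⊗ₖ spinLift (tetrahedralRotation g) * Γ *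
          (spinLift (tetrahedralRotation g) ⊗ₖ spinLift (tetrahedralRotation g))ᴴ = Γ :=
  ⟨fun ha g => conj_spinLift_eq_of_isSpinAdaptedPair (spinLift_apply (tetrahedralRotation g))
      (tetrahedralRotation_mul_conjTranspose g) ha,
    isSpinAdaptedPair_of_forall_conj_tetrahedral⟩

end Summit.Ventures.CertifiedQuantumChemistry

end
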